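import Mathlib.Analysis.InnerProductSpace.PiL2
import Mathlib.Analysis.Calculus.FDeriv.Mul
import Mathlib.Analysis.Calculus.FDeriv.Add
import Mathlib.Analysis.Calculus.ContDiff.Basic
import Mathlib.Analysis.Calculus.ContDiff.Comp
import Mathlib.Analysis.Calculus.ContDiff.Operations
import Mathlib.RingTheory.MvPolynomial.EulerIdentity
import Mathlib.Algebra.MvPolynomial.PDeriv
import HarnessLib

/-!
# Calculus of multivariate polynomials as functions on Euclidean space

Analysis support file (everything proved; one small definition, no named facts) for the
spherical-harmonics route to the sharp Poincaré inequality on spheres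
(`SphereSpectralShell`; A. Waldron, Invent. math. 217 (2019), Lemma 3.5): the bridge between
`MvPolynomial (Fin n) ℝ` (formal partial derivatives `pderiv`, homogeneity, Euler's identity)
and the Fréchet calculus of the evaluated function `x ↦ eval x p` on `EuclideanSpace ℝ (Fin n)`.

* `MvPolynomial.toFun p` — the polynomial function on `EuclideanSpace ℝ (Fin n)`;
* `hasFDerivAt_toFun` — `D(eval · p)(x) v = ∑ᵢ vᵢ · eval x (∂ᵢ p)`, `contDiff_toFun`;
* `fderiv_toFun_apply`, `fderiv_toFun_single` — `D(eval · p)(x)(eᵢ) = eval x (∂ᵢ p)`;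
* `laplacian_toFun` — `∑ₖ D²(eval · p)(x)(eₖ,eₖ) = eval x (∑ₖ ∂ₖ∂ₖ p)`;
* `fderiv_toFun_self_of_isHomogeneous` — Euler: `D(eval · p)(x) x = m · eval x p` for `p`
  homogeneous of degree `m`; `toFun_smul_of_isHomogeneous` — `p(t x) = t^m p(x)`.

References: (calculus of polynomials) [folklore]; A. Waldron, Invent. math. 217 (2019),
Lemma 3.5 [Waldron2019].
-/

noncomputable section

open scoped BigOperators

namespace Literature.Analysis.Calculus

namespace MvPoly

variable {n : ℕ}

/-- The polynomial function of `p : MvPolynomial (Fin n) ℝ` on `EuclideanSpace ℝ (Fin n)`.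
[folklore] -/
def toFun (p : MvPolynomial (Fin n) ℝ) (x : EuclideanSpace ℝ (Fin n)) : ℝ :=
  MvPolynomial.eval (fun i => x i) p

/-- Unfolding lemma. [folklore] -/
theorem toFun_apply (p : MvPolynomial (Fin n) ℝ) (x : EuclideanSpace ℝ (Fin n)) :
    toFun p x = MvPolynomial.eval (fun i => x i) p := rfl

/-- The zero polynomial is the zero function. [folklore] -/
@[simp] theorem toFun_zero (x : EuclideanSpace ℝ (Fin n)) :
    toFun (0 : MvPolynomial (Fin n) ℝ) x = 0 := by simp [toFun]

/-- Natural-number constants evaluate to themselves. [folklore] -/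
@[simp] theorem toFun_natCast (m : ℕ) (x : EuclideanSpace ℝ (Fin n)) :
    toFun (m : MvPolynomial (Fin n) ℝ) x = m := by simp [toFun]

/-- Constants evaluate to themselves. [folklore] -/
@[simp] theorem toFun_C (a : ℝ) (x : EuclideanSpace ℝ (Fin n)) :
    toFun (MvPolynomial.C a : MvPolynomial (Fin n) ℝ) x = a := by simp [toFun]

/-- The variable `Xᵢ` is the coordinate function. [folklore] -/
@[simp] theorem toFun_X (i : Fin n) (x : EuclideanSpace ℝ (Fin n)) :
    toFun (MvPolynomial.X i : MvPolynomial (Fin n) ℝ) x = x i := by simp [toFun]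

/-- Evaluation is additive. [folklore] -/
@[simp] theorem toFun_add (p q : MvPolynomial (Fin n) ℝ) (x : EuclideanSpace ℝ (Fin n)) :
    toFun (p + q) x = toFun p x + toFun q x := by simp [toFun]

/-- Evaluation is multiplicative. [folklore] -/
@[simp] theorem toFun_mul (p q : MvPolynomial (Fin n) ℝ) (x : EuclideanSpace ℝ (Fin n)) :
    toFun (p * q) x = toFun p x * toFun q x := by simp [toFun]

/-- Evaluation of finite sums. [folklore] -/
@[simp] theorem toFun_sum {κ : Type*} (s : Finset κ) (p : κ → MvPolynomial (Fin n) ℝ)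
    (x : EuclideanSpace ℝ (Fin n)) : toFun (∑ k ∈ s, p k) x = ∑ k ∈ s, toFun (p k) x := by
  simp [toFun, map_sum]

/-- Evaluation of scalar multiples. [folklore] -/
@[simp] theorem toFun_smul (a : ℝ) (p : MvPolynomial (Fin n) ℝ) (x : EuclideanSpace ℝ (Fin n)) :
    toFun (a • p) x = a * toFun p x := by simp [toFun, MvPolynomial.smul_eval]

/-- The derivative of a polynomial function, as a continuous linear map:
`v ↦ ∑ᵢ vᵢ · eval x (∂ᵢ p)`. [folklore] -/
def derivCLM (p : MvPolynomial (Fin n) ℝ) (x : EuclideanSpace ℝ (Fin n)) :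
    EuclideanSpace ℝ (Fin n) →L[ℝ] ℝ :=
  ∑ i, toFun (MvPolynomial.pderiv i p) x • EuclideanSpace.proj i

/-- Unfolding lemma for `derivCLM`. [folklore] -/
theorem derivCLM_apply (p : MvPolynomial (Fin n) ℝ) (x v : EuclideanSpace ℝ (Fin n)) :
    derivCLM p x v = ∑ i, v i * toFun (MvPolynomial.pderiv i p) x := by
  simp [derivCLM, mul_comm]

/-- **The Fréchet derivative of a polynomial function**: `D(eval · p)(x) v = ∑ᵢ vᵢ eval x (∂ᵢp)`.
[folklore] -/
theorem hasFDerivAt_toFun (p : MvPolynomial (Fin n) ℝ) (x : EuclideanSpace ℝ (Fin n)) :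
    HasFDerivAt (toFun p) (derivCLM p x) x := by
  induction p using MvPolynomial.induction_on generalizing x with
  | C a =>
    have h : derivCLM (MvPolynomial.C a : MvPolynomial (Fin n) ℝ) x = 0 := by
      ext v; simp [derivCLM_apply]
    rw [h, show toFun (MvPolynomial.C a : MvPolynomial (Fin n) ℝ) = fun _ => a from
      funext fun y => toFun_C a y]
    exact hasFDerivAt_const a x
  | add p q hp hq =>
    have h : derivCLM (p + q) x = derivCLM p x + derivCLM q x := by
      ext v; simp [derivCLM_apply, Finset.sum_add_distrib, mul_add]
    rw [h, show toFun (p + q) = fun y => toFun p y + toFun q y from funext fun y => toFun_add p q y]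
    exact (hp x).add (hq x)
  | mul_X p i hp =>
    have hXi : HasFDerivAt (fun y : EuclideanSpace ℝ (Fin n) => y i)
        (EuclideanSpace.proj (𝕜 := ℝ) (ι := Fin n) i) x :=
      (EuclideanSpace.proj (𝕜 := ℝ) (ι := Fin n) i).hasFDerivAt
    have hpd : ∀ j, toFun (MvPolynomial.pderiv j (p * MvPolynomial.X i)) x =
        toFun (MvPolynomial.pderiv j p) x * x i + (if j = i then toFun p x else 0) := by
      intro j
      rw [Derivation.leibniz, MvPolynomial.pderiv_X]
      simp only [smul_eq_mul, toFun_add, toFun_mul, toFun_X]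
      by_cases hj : j = i
      · subst hj; simp [toFun]; ring
      · simp [hj, toFun]; ring
    have h : derivCLM (p * MvPolynomial.X i) x =
        toFun p x • EuclideanSpace.proj i + x i • derivCLM p x := by
      ext v
      simp only [derivCLM_apply, hpd, mul_add, Finset.sum_add_distrib, mul_ite, mul_zero,
        Finset.sum_ite_eq', Finset.mem_univ, if_true, FunLike.coe_add, Pi.add_apply,
        FunLike.coe_smul, Pi.smul_apply, smul_eq_mul, Finset.mul_sum]
      rw [add_comm]
      congr 1
      · rw [show (EuclideanSpace.proj (𝕜 := ℝ) (ι := Fin n) i) v = v i from rfl]; ring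
      · exact Finset.sum_congr rfl fun j _ => by ring
    rw [h, show toFun (p * MvPolynomial.X i) = fun y => toFun p y * y i from
      funext fun y => by simp]
    exact (hp x).mul hXi

/-- Polynomial functions are differentiable. [folklore] -/
theorem differentiable_toFun (p : MvPolynomial (Fin n) ℝ) : Differentiable ℝ (toFun p) :=
  fun x => (hasFDerivAt_toFun p x).differentiableAt

/-- `D(eval · p)(x) v = ∑ᵢ vᵢ eval x (∂ᵢ p)`. [folklore] -/
theorem fderiv_toFun_apply (p : MvPolynomial (Fin n) ℝ) (x v : EuclideanSpace ℝ (Fin n)) :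
    fderiv ℝ (toFun p) x v = ∑ i, v i * toFun (MvPolynomial.pderiv i p) x := by
  rw [(hasFDerivAt_toFun p x).fderiv, derivCLM_apply]

/-- `D(eval · p)(x)(eᵢ) = eval x (∂ᵢ p)` for the standard basis vector `eᵢ`. [folklore] -/
theorem fderiv_toFun_single (p : MvPolynomial (Fin n) ℝ) (x : EuclideanSpace ℝ (Fin n)) (i : Fin n) :
    fderiv ℝ (toFun p) x (EuclideanSpace.single i 1) = toFun (MvPolynomial.pderiv i p) x := by
  rw [fderiv_toFun_apply]
  simp [PiLp.single_apply, eq_comm]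

/-- The derivative of a polynomial function is again a polynomial function in `x` (for fixed
direction), so polynomial functions are smooth. [folklore] -/
theorem fderiv_toFun_eq (p : MvPolynomial (Fin n) ℝ) (v : EuclideanSpace ℝ (Fin n)) :
    (fun x => fderiv ℝ (toFun p) x v) = toFun (∑ i, v i • MvPolynomial.pderiv i p) := by
  funext x
  rw [fderiv_toFun_apply, toFun_sum]
  simp

/-- Polynomial functions are smooth. [folklore] -/
theorem contDiff_toFun (p : MvPolynomial (Fin n) ℝ) {m : WithTop ℕ∞} : ContDiff ℝ m (toFun p) := by
  refine MvPolynomial.induction_on (motive := fun q => ContDiff ℝ m (toFun q)) p (fun a => ?_)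
    (fun p q hp hq => ?_) (fun p i hp => ?_)
  · rw [show toFun (MvPolynomial.C a : MvPolynomial (Fin n) ℝ) = fun _ => a from
      funext fun y => toFun_C a y]
    exact contDiff_const
  · rw [show toFun (p + q) = fun y => toFun p y + toFun q y from funext fun y => toFun_add p q y]
    exact ContDiff.add hp hq
  · rw [show toFun (p * MvPolynomial.X i) = fun y => toFun p y * y i from
      funext fun y => by simp]
    exact ContDiff.mul hp (EuclideanSpace.proj (𝕜 := ℝ) (ι := Fin n) i).contDiff

/-- **The Laplacian of a polynomial function**: `∑ₖ D²(eval · p)(x)(eₖ, eₖ) = eval x (∑ₖ ∂ₖ∂ₖ p)`.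
[folklore] -/
theorem laplacian_toFun (p : MvPolynomial (Fin n) ℝ) (x : EuclideanSpace ℝ (Fin n)) :
    ∑ k, fderiv ℝ (fderiv ℝ (toFun p)) x (EuclideanSpace.single k 1) (EuclideanSpace.single k 1) =
      toFun (∑ k, MvPolynomial.pderiv k (MvPolynomial.pderiv k p)) x := by
  rw [toFun_sum]
  refine Finset.sum_congr rfl fun k _ => ?_
  have h1 : (fun y => fderiv ℝ (toFun p) y (EuclideanSpace.single k 1)) =
      toFun (MvPolynomial.pderiv k p) := funext fun y => fderiv_toFun_single p y k
  have h2c : ContDiff ℝ 2 (toFun p) := contDiff_toFun p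
  have hc : DifferentiableAt ℝ (fderiv ℝ (toFun p)) x :=
    (h2c.fderiv_right (m := 1) (by norm_num)).differentiable (by norm_num) x
  have h2 : fderiv ℝ (fderiv ℝ (toFun p)) x (EuclideanSpace.single k 1) (EuclideanSpace.single k 1) =
      fderiv ℝ (fun y => fderiv ℝ (toFun p) y (EuclideanSpace.single k 1)) x
        (EuclideanSpace.single k 1) := by
    rw [fderiv_clm_apply hc (differentiableAt_const _)]
    simp
  rw [h2, h1, fderiv_toFun_single]

/-- **Euler's identity** for the polynomial function of a homogeneous polynomial:
`D(eval · p)(x) x = m · eval x p`. [folklore] -/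
theorem fderiv_toFun_self_of_isHomogeneous {p : MvPolynomial (Fin n) ℝ} {m : ℕ}
    (hp : p.IsHomogeneous m) (x : EuclideanSpace ℝ (Fin n)) :
    fderiv ℝ (toFun p) x x = m * toFun p x := by
  rw [fderiv_toFun_apply]
  have h := congrArg (fun q => toFun q x) hp.sum_X_mul_pderiv
  simp only [toFun_sum, toFun_mul, toFun_X, nsmul_eq_mul, toFun_natCast] at h
  rw [← h]

/-- Homogeneity of the polynomial function: `p(t • x) = t^m p(x)`. [folklore] -/
theorem toFun_smul_of_isHomogeneous {p : MvPolynomial (Fin n) ℝ} {m : ℕ}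
    (hp : p.IsHomogeneous m) (t : ℝ) (x : EuclideanSpace ℝ (Fin n)) :
    toFun p (t • x) = t ^ m * toFun p x := by
  simp only [toFun, PiLp.smul_apply, smul_eq_mul, MvPolynomial.eval_eq', Finset.mul_sum]
  refine Finset.sum_congr rfl fun d hd => ?_
  have hdeg : ∑ i, d i = m := by
    have h := hp (MvPolynomial.mem_support_iff.1 hd)
    simp only [Pi.one_apply, Finsupp.weight_apply, smul_eq_mul, mul_one] at h
    rw [← h, Finsupp.sum_fintype _ _ (by simp)]
  simp_rw [mul_pow, Finset.prod_mul_distrib, Finset.prod_pow_eq_pow_sum, hdeg]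
  ring

end MvPoly

end Literature.Analysis.Calculus
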